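import Literature.MathematicalPhysics.QuantumFieldTheory.Balaban1983to89.Node00.Record12CarriersB12Fundamental
import Literature.MathematicalPhysics.QuantumFieldTheory.Balaban1983to89.B12Lemma4ChartSizes

/-!
# NODE 00 (YM-PLAN Track A) — STAGE 3′(X.B12) COMPANION, MODULE D: THE CHART PIN OF THE LEMMA-4 LETTERS `𝐊`, `𝐀₂` (AND `𝐇`, `H₁`, `ℓ`) AT NODE 00's OBJECTS —
# [15]'s scheme (174) `B11Eq174Chart.chartH` ON dag-n09-b's PRESENTATION (`ChartB12Run`: the coarse datum `B` of (3.30) RESIDUAL), THE CHART LAWS DISPLAYED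
# (`ChartB12Laws` = dag-n09-b's hypotheses verbatim), THE BY-REFERENCE RESIDUE `JInputsRef` (= p07's `JInputs` with the [15]-function letters as
# parameters and the eight size fields removed), THE CHARTED FUNDAMENTAL-CASE RECORD `ChartB12Inputs` AND THE KNIT
# `ChartB12Inputs.toFundamental : … → B12FundamentalInputs Rz cB χ.toResid` (the eight sizes := dag-n09-b's `ineq337_∗ ∕ ineq345_∗ ∕ ineq350_∗` BY NAME)

NODE 00 COMPANION MODULE (seat `pub-ymgap-node00-def-B12` g4, 2026-08-27; HUMAN RULING D-0062; director-ym R141 (A) + (c) «s3 = JInputs → CarriersB12 is a DEFINITION»;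
g32's `Node00/CarriersB12` header «a name-level pin of the chart is a successor»; dag-n09-c HANDOFF §3 t1; dag-ref-C READ138 reader rule «N09's discharge question =
inhabiting `B12FundamentalInputs (θ.Rz P.K) θ.s2.cB (lam12 P)` with the run's OWN letters»).  APPEND-ONLY GROWTH (D-0064): a NEW importing module; nothing landed
is edited; everything it reads is CONSUMED BY NAME — g32's `IdxB12 ∕ ResidB12Run ∕ F12OfRecord ∕ B12LeafOfRecord` (`Node00/CarriersB12`), modules A ∕ C
(`B12Package`, `B12FundamentalInputs` + its faces, `Node00/Record12CarriersB12Package`, `Node00/Record12CarriersB12Fundamental`), dag-n09-c's closer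
(`Node00/CarriersB12FundamentalCase`, through module C), p07's `B12Lemma4ConcreteFrame.JInputs`, dag-n09-b's `B12Lemma4ChartSizes` (v1 §§2–4), lit [B11]
`B11Eq174Chart.Regime ∕ chartH`.

PRINT.  [I] = Bałaban, *Renormalization group approach to lattice gauge field theories. I*, CMP 109 (1987), §3 pp. 275–280; [15] = Bałaban, *The variational
problem …*, CMP 102 (1985), (174)–(177) pp. 305–306, Prop. 6 p. 295, Prop. 9 p. 309.  p. 275: *«Let us consider at first the fundamental case X ⊂ □̃²»*
(located p. 273 with «□₀ = □̃⁵»); p. 276 (3.30): *«Let us denote B = (1/iη) log [exp iηA · exp(iL⁻¹η𝐇_{k+1}(□₀, (1/i) log V))] on □₀ … The function B above is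
defined on the set of bonds determining U_j(□₀)»*, (3.31) the class of `𝐀`; p. 277 (3.37): *«|𝐇_j(□₀, τQ(L⁻¹η𝐇_{k+1}(□₀, (1/i) log V)))|, |∇^η …| <
B₃²O(1)Mα₀L^{j−1}η on □̃³»*; p. 279: *«the function 𝐇_j is given by (174) [15], i.e. 𝐇_j(□₀, B) = H_{1,j}B − H_jD_j(…), where the functions on the right-hand
side are at least of second order, except the first term»* and (3.45) *«|∂^ξ𝐇_j(□₀, ·) − ∂^ξH_{1,j}·| < B₃(B₃O(1)Mα₀L^{j−1}η)² on □̃³»*; pp. 279–280: *«We replace τQ′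
by the variable B′ with values in 𝔤ᶜ, and we prove (3.36) for B′ satisfying |B′| < α₃ … 𝐇_j(□₀, τB + B′) = 𝐇_j(□₀, τB) + 𝐀₂ (3.50), where the last equality is
a definition of 𝐀₂. It implies |𝐀₂|, |∇^η𝐀₂| ≤ B₃|B′| < B₃α₃»*; Lemma 4 (3.53) p. 280: *«(U_j(□₀, exp i(τB + B′)), J(□₀, exp i(τB + B′))) ∈ Uᶜ_j(X, α₀, α₁) …
The functions in (3.53) are analytic on the above spaces.»*  [15] (174)–(175): the chart `𝓗(𝔄) = T(X(𝔄) + 𝔄)`, `X = −𝒢W(X + 𝔄)` on the ball `‖X‖ ≤ ε₄` — lit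
[B11]'s `chartH 𝒢 0 W 0 T ε₄` under the contraction regime of Prop. 6 (`Regime 𝒢 0 W B₀ θ C₄ a₃ jc a ε₄`), as in dag-n09-b's `B12Lemma4ChartSizes`.

WHAT IS DEFINED.
§1 `ChartB12Run P N M 𝒴 𝒵` — a run of NODE 00's [B12] layer whose Lemma-4 letters are CHARTED: the instance index `idx : IdxB12`; [15]'s scheme `(𝒢, W, T, ε₄)`
   of the `j`-th chart `𝐇_j(□₀, ·)` with the regime constants `B₀, θ, C₄, a₃, jc, a` and the Lipschitz ∕ second-order constants `Klip, K_D` of `T`; the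
   PRESENTATION `ev : 𝒴 →ₗ[ℂ] (bond functions)` (dag-n09-b's shape: the (115)-space [15] read on the bonds of `T_ξ`); the linear datum map `lin = H_{1,j}` ((103)
   [15]) on the carrier of `B′`; the COARSE DATUM `fldB : (𝐔, 𝐀) ↦ B` of (3.30)∕(3.48) — RESIDUAL (data, no law: the `(k+1)`-st chart (3.27), the axial gauge `V(𝐔)`
   (3.26), `Q` (97) [12] and the BCH composite (3.30) have no tree object; dag-n09-b's `norm_datum_le_of_chart` is the route to its size); the class (3.31); the
   constants of g32's residual layer.  The letters are then DEFINITIONS: `dat = lin ∘ fldB` (`𝔄 = H_{1,j}B`), `K (𝐔, 𝐀, τ) = ev 𝓗(τ𝔄)` ((3.37)),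
   `A₂ (𝐔, 𝐀, τ, B′) = ev (𝓗(τ𝔄 + H_{1,j}B′) − 𝓗(τ𝔄))` ((3.50)), `H = ev 𝓗(𝔄)` ((3.39)), `H₁ = ev 𝔄`, `ℓ = ξ⁻¹·(plaquette combination of H₁)` ((3.45)); `toResid`
   forgets to g32's residual layer (`rfl` faces), so EVERY landed [B12] carrier ∕ package ∕ record applies to `χ.toResid` BY NAME; `K_add_A₂` reads (3.50)₁ back:
   `𝐊 + 𝐀₂ = ev 𝓗(H_{1,j}(τB + B′))` — the argument of (3.53).
§2 `ChartB12Laws Rz cB χ` (a `Prop`) — dag-n09-b's hypotheses of `ineq337_∗ ∕ ineq345_∗ ∕ ineq350_∗` AS DISPLAYED LAWS of the run: the regime, `0 ≤ jc`, `T 0 = 0`,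
   `T` `Klip`-Lipschitz and of second order (`K_D`) on the ball `ε₄ + a`, the presentation dominated letter- and gradient-wise and `𝔤ᶜ`-valued (GLOBAL `∀ b` —
   LOCATED, SAID: print «on □̃³», p07's `JInputs.hK ∕ hH` are global too; dag-n09-b v2 §§5–6 localise), the datum sizes `‖𝔄‖ < a`, `‖τ𝔄 + H_{1,j}B′‖ < a` on the
   printed domain, and the three lines of constant arithmetic behind print's constants.  `chartB12Laws_degenerate`: the laws are jointly satisfiable (at the zero
   scheme; a sanity witness, physically vacuous).
§3 `JInputsRef` — p07's by-reference package `JInputs` for one value of the variables with the [15]-function letters `𝐇, H₁` turned into PARAMETERS and the fields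
   `ℓ, hKgc, hAgc` and the eight sizes (3.37)×4, (3.45)×2, (3.50)×2 REMOVED (what stays: the upper-space datum (3.40), the gauge transformations of
   (3.26)∕(3.37)∕(3.39)∕(3.42) with their costs, the identities (3.39)+(3.37), (3.42), (3.38)×2, the (J2)×2 ∕ (J3) inputs — [12]∕[14]∕[15] statements of other kinds);
   `JInputsRef.toJInputs` puts the removed fields back from hypotheses; `JInputsRef.ofJInputs` forgets; `toJInputs_ofJInputs : … = J` (`rfl`).
§4 `ChartB12Inputs Rz cB χ` — module C's `B12FundamentalInputs` at `χ.toResid` with `inputs` replaced by `inputsRef` (a `JInputsRef` AT THE CHARTED LETTERS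
   `χ.K, χ.A₂, χ.H, χ.H₁`); THE KNIT `ChartB12Inputs.toFundamental h laws : B12FundamentalInputs Rz cB χ.toResid`, whose eight size fields are dag-n09-b's theorems
   BY NAME at `(χ.ev, laws.regime, χ.dat, χ.lin)`, whose `ℓ` is `χ.ℓ` and whose `hKgc ∕ hAgc` are `laws.ev_gc` (`rfl` faces `toFundamental_inputs_H ∕ _H₁ ∕ _ℓ`);
   hence module C BY NAME: `package_of_chart`, `leaf_of_chart` (the `b12` leaf `B12LeafOfRecord Rz cB χ.toResid`).
§5 At def-T's STAGE 12: `b12LeafOfRecord₁₂_of_chart` (the leaf of THE NAMED charted layer) and `exists_world_b12_of_chart` (module C's proviso-record world face for a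
   charted family `fun p => (χ p).toResid`).

HONEST FRAMING (binding).  OBJECTS + kernel bookkeeping.  The knit APPLIES dag-n09-b's PROVED chart-size theorems by name — no estimate is proved here; the coarse
datum's structure, the gauge transformations ∕ costs ∕ identities ∕ (J2)(J3) (`JInputsRef`), the letters' analyticity (`hKan ∕ hA2an`; at the pin a consequence of
[15] Prop. 7 and the datum's analyticity p. 276 — successor work) and the chart laws stay BY REFERENCE, DISPLAYED; nothing of [I] ∕ [15] is asserted; R4's instance
count is untouched (5∕27); N09 is NOT discharged by this file; one finite T⁴ programme at fixed ε, Bałaban as printed — NOT continuum ∕ ℝ⁴ ∕ infinite volume ∕ OS ∕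
mass gap ∕ Clay.  No `sorry`, no `axiom`, no `opaque`, no `instance`, no `notation`.
-/

noncomputable section

namespace Literature.MathematicalPhysics.QuantumFieldTheory.Balaban1983to89.Node00

open T4Continuum AveragingRT T4FiniteEpsInhabited FlowStep FlowStepRuns DagBinding T4DatumAssembly
open B12RegularSpaces111 (Frame Region StepConsts space space' expI grad CondIV Model Satisfies plaq gaugeU)
open B12Eq18Current (ofBackground current)
open B12Eq311CurrentExpansion (C311 lapCur)
open B12Lemma4ConcreteFrame (JInputs LettersAnalyticAt)
open B12Lemma4Models (slProj)
open B12RegularSpaces111SpecialUnitary (suModel)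
open B11Eq174Chart (Regime chartH)
open B12Lemma4ChartSizes (ineq337_letter ineq337_grad ineq337_letter_one ineq337_grad_one ineq345_tau ineq345_one ineq350_letter ineq350_grad)
open Step B14DomainGeom B14.Eq213MaximalDomains B15Eq112TorusCover TreeLengthTorus
open scoped Matrix.Norms.L2Operator

/-! ## §1. The charted run: [15]'s scheme + presentation + linear datum map + residual coarse datum; the letters `𝔄, 𝐊, 𝐀₂, 𝐇, H₁, ℓ` as definitions -/

section Chart

variable (P : Params) (N M : ℕ) (𝒴 𝒵 : Type) [NormedAddCommGroup 𝒴] [NormedSpace ℂ 𝒴] [NormedAddCommGroup 𝒵] [NormedSpace ℂ 𝒵]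

/-- **A CHARTED RUN of NODE 00's [B12] layer** (g32's `ResidB12Run` with the letters `𝐊`, `𝐀₂` PINNED through [15]'s chart (174) on a presentation, the coarse
datum `B` of (3.30) residual).  Fields: the instance index; [15]'s scheme `X = −𝒢W(X + 𝔄)`, `𝓗(𝔄) = T(X(𝔄) + 𝔄)` on `‖X‖ ≤ ε₄` (`𝒢`, `W`, `T`, `ε₄`) with the
regime constants of Prop. 6 [15] (`B₀, θ, C₄, a₃, jc, a`) and the Lipschitz ∕ second-order constants `Klip, K_D` of `T`; the presentation `ev` of the (115)-space on
the bonds of `T_ξ` (dag-n09-b); `lin = H_{1,j}` ((103) [15], the linear minimiser) on the bond functions; the coarse datum `fldB : (𝐔, 𝐀) ↦ B` of (3.30) (RESIDUAL: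
*«B = (1/iη) log [exp iηA · exp(iL⁻¹η𝐇_{k+1}(□₀, (1/i) log V))] … defined on the set of bonds determining U_j(□₀)»*); the class (3.31) `A331`; the constants
`B₃, O(1), β₀, β, α₀, …, α₃, B₃″` of the residual layer.
[cite: Balaban1987RG1, (3.26)–(3.31) pp.275–276, (3.37) p.277, (3.48)–(3.50) pp.279–280] [cite: Balaban1985Variational, (174)–(175) p.305, Prop. 6 p.295] -/
structure ChartB12Run where
  /-- the instance `(k, j, □, X)` -/
  idx : IdxB12 P M
  /-- [15]'s `𝒢` of (174) -/
  𝒢 : 𝒵 →L[ℂ] 𝒴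
  /-- [15]'s `W` of (174) (at least of second order) -/
  W : 𝒴 → 𝒵
  /-- [15]'s `T` of (175): `𝓗(𝔄) = T(X(𝔄) + 𝔄)` -/
  T : 𝒴 → 𝒴
  /-- the radius `ε₄` of (174) and the constants of the regime (Prop. 6 [15]) and of `T` -/
  (ε₄ B₀ θ C₄ a₃ jc a Klip K_D : ℝ)
  /-- the presentation of the (115)-space on the bonds of `T_ξ` -/
  ev : 𝒴 →ₗ[ℂ] (PBond P 0 → MatA N)
  /-- `H_{1,j}` ((103) [15]) on the bond functions `B′`, `B` -/
  lin : (PBond P 0 → MatA N) →L[ℂ] 𝒴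
  /-- the coarse datum `(𝐔, 𝐀) ↦ B` of (3.30) (residual) -/
  fldB : FieldPair P 0 (MatA N)ˣ (MatA N) → (PBond P 0 → MatA N) → PBond P 0 → MatA N
  /-- the class (3.31) of the fields `𝐀` -/
  A331 : Set (PBond P 0 → MatA N)
  /-- the constants of the layer (g32's `ResidB12Run`) -/
  (B₃ O₁ β₀ β α₀ α₁ α₂ α₃ B₃'' : ℝ)

namespace ChartB12Run

variable {P N M 𝒴 𝒵}
variable (χ : ChartB12Run P N M 𝒴 𝒵)

/-- **The datum `𝔄(𝐔, 𝐀) = H_{1,j}B`** of the `j`-th chart ((174) [15] at `B` of (3.30)). [cite: Balaban1987RG1, (3.30) p.276, p.279 («𝐇_j(□₀, B) = H_{1,j}B − …»)] -/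
def dat (Φ : FieldPair P 0 (MatA N)ˣ (MatA N)) (A : PBond P 0 → MatA N) : 𝒴 :=
  χ.lin (χ.fldB Φ A)

/-- **`𝐊 (𝐔, 𝐀, τ) = ev 𝓗(τ𝔄)`** — print's `𝐇_j(□₀, τQ(L⁻¹η𝐇_{k+1}(□₀, (1/i) log V)))` of (3.37), PINNED through [15]'s chart.
[cite: Balaban1987RG1, (3.37) p.277] [cite: Balaban1985Variational, (174)–(175) p.305] -/
def K (Φ : FieldPair P 0 (MatA N)ˣ (MatA N)) (A : PBond P 0 → MatA N) (τ : ℝ) (b : PBond P 0) : MatA N :=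
  χ.ev (chartH χ.𝒢 0 χ.W 0 χ.T χ.ε₄ ((τ : ℂ) • χ.dat Φ A)) b

/-- **`𝐀₂ (𝐔, 𝐀, τ, B′) = ev (𝓗(τ𝔄 + H_{1,j}B′) − 𝓗(τ𝔄))`** — print's definition (3.50) of `𝐀₂` as the increment of the chart, PINNED.
[cite: Balaban1987RG1, (3.50) pp.279–280] [cite: Balaban1985Variational, (174)–(175) p.305] -/
def A₂ (Φ : FieldPair P 0 (MatA N)ˣ (MatA N)) (A : PBond P 0 → MatA N) (τ : ℝ) (B' : PBond P 0 → MatA N) (b : PBond P 0) : MatA N :=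
  χ.ev (chartH χ.𝒢 0 χ.W 0 χ.T χ.ε₄ ((τ : ℂ) • χ.dat Φ A + χ.lin B') - chartH χ.𝒢 0 χ.W 0 χ.T χ.ε₄ ((τ : ℂ) • χ.dat Φ A)) b

/-- **`𝐇 (𝐔, 𝐀) = ev 𝓗(𝔄)`** — the configuration of (3.39) (`τ = 1`). [cite: Balaban1987RG1, (3.39) p.277] [cite: Balaban1985Variational, (174)–(175) p.305] -/
def H (Φ : FieldPair P 0 (MatA N)ˣ (MatA N)) (A : PBond P 0 → MatA N) (b : PBond P 0) : MatA N :=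
  χ.ev (chartH χ.𝒢 0 χ.W 0 χ.T χ.ε₄ (χ.dat Φ A)) b

/-- **`H₁ (𝐔, 𝐀) = ev 𝔄 = ev H_{1,j}B`** — the first-order term of p. 279. [cite: Balaban1987RG1, p.279 («except the first term»)] -/
def H₁ (Φ : FieldPair P 0 (MatA N)ˣ (MatA N)) (A : PBond P 0 → MatA N) (b : PBond P 0) : MatA N :=
  χ.ev (χ.dat Φ A) b

/-- **Forget the chart**: the residual layer of g32 (`ResidB12Run`) presented by the charted run — the letters `𝐊`, `𝐀₂` are the pinned ones.
[cite: Balaban1987RG1, Lemma 4 (3.53) p.280] -/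
def toResid : ResidB12Run P N M where
  idx := χ.idx
  K := χ.K
  A₂ := χ.A₂
  A331 := χ.A331
  B₃ := χ.B₃
  O₁ := χ.O₁
  β₀ := χ.β₀
  β := χ.β
  α₀ := χ.α₀
  α₁ := χ.α₁
  α₂ := χ.α₂
  α₃ := χ.α₃
  B₃'' := χ.B₃''

/-- The presented residual layer has the charted run's instance index. [cite: Balaban1987RG1, Lemma 4 (3.53) p.280 (bookkeeping)] -/
@[simp] theorem toResid_idx : χ.toResid.idx = χ.idx := rfl

/-- The presented residual layer's `𝐊` IS the pinned `𝐊 = ev 𝓗(τ𝔄)`. [cite: Balaban1987RG1, (3.37) p.277 (bookkeeping)] -/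
@[simp] theorem toResid_K : χ.toResid.K = χ.K := rfl

/-- The presented residual layer's `𝐀₂` IS the pinned increment of the chart (3.50). [cite: Balaban1987RG1, (3.50) p.279 (bookkeeping)] -/
@[simp] theorem toResid_A₂ : χ.toResid.A₂ = χ.A₂ := rfl

/-- The presented residual layer's class (3.31) is the charted run's. [cite: Balaban1987RG1, (3.31) p.276 (bookkeeping)] -/
@[simp] theorem toResid_A331 : χ.toResid.A331 = χ.A331 := rfl

/-- The presented residual layer's `B₃″` is the charted run's. [cite: Balaban1987RG1, Lemma 4 (3.53) p.280 (bookkeeping)] -/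
@[simp] theorem toResid_B₃'' : χ.toResid.B₃'' = χ.B₃'' := rfl

/-- The presented residual layer's `α₀` slot (the radius of the (3.40)-space's current condition) is the charted run's. [cite: Balaban1987RG1, (3.40) p.278 (bookkeeping)] -/
@[simp] theorem toResid_α₀ : χ.toResid.α₀ = χ.α₀ := rfl

/-- The Lemma-4 constants of the charted run are those of its fields (`M`, `L` from the parameters). [cite: Balaban1987RG1, Lemma 4 p.280] -/
theorem toResid_consts : χ.toResid.consts = ⟨χ.B₃, χ.O₁, (M : ℝ), (P.L : ℝ), χ.β₀, χ.β, χ.α₀, χ.α₁, χ.α₂, χ.α₃⟩ := rfl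

/-- **`ℓ (𝐔, 𝐀) = ∂^ξ H_{1,j}B`** on plaquettes — the linear term subtracted in (3.45), at the scale `ξ = L^{-j}` of the `j`-th space.
[cite: Balaban1987RG1, (3.45) p.279] -/
def ℓ (cB : ℝ) (Φ : FieldPair P 0 (MatA N)ˣ (MatA N)) (A : PBond P 0 → MatA N) (p : Plaq P 0) : MatA N :=
  ((χ.toResid.csX cB).ξ : ℂ)⁻¹ •
    (χ.H₁ Φ A ⟨p.src, p.μ⟩ + χ.H₁ Φ A ⟨p.src.shift p.μ, p.ν⟩ - χ.H₁ Φ A ⟨p.src.shift p.ν, p.μ⟩ - χ.H₁ Φ A ⟨p.src, p.ν⟩)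

/-- **(3.50), first display, read back at the pin**: `𝐊 + 𝐀₂ = ev 𝓗(τ𝔄 + H_{1,j}B′) = ev 𝓗(H_{1,j}(τB + B′))` — the configuration `𝐇_j(□₀, τB + B′)` entering
(3.53). [cite: Balaban1987RG1, (3.50) p.279, (3.53) p.280] -/
theorem K_add_A₂ (Φ : FieldPair P 0 (MatA N)ˣ (MatA N)) (A : PBond P 0 → MatA N) (τ : ℝ) (B' : PBond P 0 → MatA N) (b : PBond P 0) :
    χ.K Φ A τ b + χ.A₂ Φ A τ B' b = χ.ev (chartH χ.𝒢 0 χ.W 0 χ.T χ.ε₄ (χ.lin ((τ : ℂ) • χ.fldB Φ A + B'))) b := by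
  simp only [K, A₂, dat, map_add, map_smul, map_sub, Pi.sub_apply]
  abel

end ChartB12Run

/-- The carrier of charted runs is inhabited (the zero scheme on any pair of spaces; junk, for `Nonempty` bookkeeping only — as g32's `nonempty_residB12Run`).
[cite: Balaban1987RG1, Lemma 4 (3.53) p.280 (bookkeeping)] -/
theorem nonempty_chartB12Run : Nonempty (ChartB12Run P N M 𝒴 𝒵) :=
  ⟨{ idx := { k := 1, j := 1, one_le_j := le_rfl, j_le_k := le_rfl, cube := fun _ => 0, X := Sect2.cubeDom P M 1 fun _ => 0 },
     𝒢 := 0, W := fun _ => 0, T := fun Y => Y, ε₄ := 0, B₀ := 0, θ := 0, C₄ := 0, a₃ := 0, jc := 0, a := 0, Klip := 0, K_D := 0,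
     ev := 0, lin := 0, fldB := fun _ _ _ => 0, A331 := Set.univ,
     B₃ := 0, O₁ := 0, β₀ := 0, β := 0, α₀ := 0, α₁ := 0, α₂ := 0, α₃ := 0, B₃'' := 0 }⟩

/-! ## §2. The chart laws (dag-n09-b's hypotheses, displayed) -/

variable {P N M 𝒴 𝒵}

/-- **THE CHART LAWS of a charted run at NODE 00's objects** — exactly the hypotheses of dag-n09-b's `B12Lemma4ChartSizes.ineq337_∗ ∕ ineq345_∗ ∕ ineq350_∗`: the
contraction regime of Prop. 6 [15] for `(𝒢, 0, W)`; `0 ≤ jc`; `T 0 = 0`, `T` `Klip`-Lipschitz and `‖TY − Y‖ ≤ K_D‖Y‖²` on the ball `ε₄ + a` ((177) [15]); the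
presentation dominated by the norm letter-wise and `∇^ξ`-wise (GLOBAL in the bond — located: print's (3.37), (3.45) are «on □̃³») and `𝔤ᶜ`-valued; the datum sizes
`‖𝔄(𝐔, 𝐀)‖ < a` and `‖τ𝔄 + H_{1,j}B′‖ < a` on the printed domain `(𝐔, 𝐉) ∈ (3.40)-space, 𝐀 ∈ (3.31), τ ∈ [0,1], |B′| < α₃` (print p. 277 via (3.27) and (97)
[12] — dag-n09-b's `norm_datum_le_of_chart`); and the constant arithmetic making `Klip(ε₄ + a)`, `2(K_D + B₀C₄)(ε₄ + a)²`, `Klip(κ/(1−κ) + 1)‖H_{1,j}‖` at most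
print's `B₃²O(1)Mα₀L^{j−1}η`, `B₃(B₃O(1)Mα₀L^{j−1}η)²`, `B₃`.  A `Prop`; BY REFERENCE (nothing of [15] is proved here).
[cite: Balaban1987RG1, (3.37) p.277, (3.45) p.279, (3.50) pp.279–280] [cite: Balaban1985Variational, Prop. 6 p.295, (176)–(177) p.306, Prop. 9 p.309] -/
structure ChartB12Laws (Rz : Sect2.Residual P (MatA N)) (cB : ℝ) (χ : ChartB12Run P N M 𝒴 𝒵) : Prop where
  regime : Regime χ.𝒢 0 χ.W χ.B₀ χ.θ χ.C₄ χ.a₃ χ.jc χ.a χ.ε₄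
  jc_nonneg : 0 ≤ χ.jc
  T_zero : χ.T 0 = 0
  Klip_pos : 0 < χ.Klip
  lip : ∀ x y : 𝒴, ‖x‖ < χ.ε₄ + χ.a → ‖y‖ < χ.ε₄ + χ.a → ‖χ.T x - χ.T y‖ ≤ χ.Klip * ‖x - y‖
  KD_nonneg : 0 ≤ χ.K_D
  second : ∀ Y : 𝒴, ‖Y‖ < χ.ε₄ + χ.a → ‖χ.T Y - Y‖ ≤ χ.K_D * ‖Y‖ ^ 2
  ev_le : ∀ (Y : 𝒴) (b : PBond P 0), ‖χ.ev Y b‖ ≤ ‖Y‖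
  grad_ev_le : ∀ (Y : 𝒴) (μ ν : Fin P.d) (y : Site P 0), ‖grad (χ.toResid.csX cB).ξ μ (fun z => χ.ev Y ⟨z, ν⟩) y‖ ≤ ‖Y‖
  ev_gc : ∀ (Y : 𝒴) (b : PBond P 0), χ.ev Y b ∈ (suModel N).gc
  dat_lt : ∀ (Φ : FieldPair P 0 (MatA N)ˣ (MatA N)) (A : PBond P 0 → MatA N),
    Φ ∈ space (suModel N) (χ.toResid.frameBox Rz) (χ.toResid.csBox cB) ((1 + 2 * χ.toResid.consts.β) * χ.toResid.consts.α₀)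
        ((1 + 2 * χ.toResid.consts.β) * χ.toResid.consts.α₁) χ.toResid.α₀ →
      A ∈ χ.toResid.A331 → ‖χ.dat Φ A‖ < χ.a
  dat_lin_lt : ∀ (Φ : FieldPair P 0 (MatA N)ˣ (MatA N)) (A : PBond P 0 → MatA N) (τ : ℝ) (B' : PBond P 0 → MatA N),
    Φ ∈ space (suModel N) (χ.toResid.frameBox Rz) (χ.toResid.csBox cB) ((1 + 2 * χ.toResid.consts.β) * χ.toResid.consts.α₀)
        ((1 + 2 * χ.toResid.consts.β) * χ.toResid.consts.α₁) χ.toResid.α₀ →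
      A ∈ χ.toResid.A331 → 0 ≤ τ → τ ≤ 1 → ‖B'‖ < χ.toResid.consts.α₃ → ‖(τ : ℂ) • χ.dat Φ A + χ.lin B'‖ < χ.a
  h337 : χ.Klip * (χ.ε₄ + χ.a) ≤ χ.toResid.consts.B₃ ^ 2 * χ.toResid.consts.O₁ * χ.toResid.consts.M * χ.toResid.consts.α₀ *
    (χ.toResid.consts.L ^ (χ.toResid.idx.j - 1) * χ.toResid.idx.η)
  h345 : 2 * (χ.K_D + χ.B₀ * χ.C₄) * (χ.ε₄ + χ.a) ^ 2 < χ.toResid.consts.B₃ *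
    (χ.toResid.consts.B₃ * χ.toResid.consts.O₁ * χ.toResid.consts.M * χ.toResid.consts.α₀ * (χ.toResid.consts.L ^ (χ.toResid.idx.j - 1) * χ.toResid.idx.η)) ^ 2
  h350 : χ.Klip * ((χ.θ + 4 * χ.B₀ * χ.C₄ * (χ.ε₄ + χ.a)) / (1 - (χ.θ + 4 * χ.B₀ * χ.C₄ * (χ.ε₄ + χ.a))) + 1) * ‖χ.lin‖ ≤ χ.toResid.consts.B₃

namespace ChartB12Laws

variable {Rz : Sect2.Residual P (MatA N)} {cB : ℝ} {χ : ChartB12Run P N M 𝒴 𝒵}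

/-- Under the laws the pinned `𝐊` is `𝔤ᶜ`-valued (p07's `JInputs.hKgc`). [cite: Balaban1987RG1, p.279 («B′ with values in 𝔤ᶜ»), (3.53) p.280] -/
theorem K_mem_gc (laws : ChartB12Laws Rz cB χ) (Φ : FieldPair P 0 (MatA N)ˣ (MatA N)) (A : PBond P 0 → MatA N) (τ : ℝ) (b : PBond P 0) :
    χ.K Φ A τ b ∈ (suModel N).gc :=
  laws.ev_gc _ b

/-- Under the laws the pinned `𝐀₂` is `𝔤ᶜ`-valued (p07's `JInputs.hAgc`). [cite: Balaban1987RG1, p.279 («B′ with values in 𝔤ᶜ»), (3.50) p.280] -/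
theorem A₂_mem_gc (laws : ChartB12Laws Rz cB χ) (Φ : FieldPair P 0 (MatA N)ˣ (MatA N)) (A : PBond P 0 → MatA N) (τ : ℝ) (B' : PBond P 0 → MatA N)
    (b : PBond P 0) : χ.A₂ Φ A τ B' b ∈ (suModel N).gc :=
  laws.ev_gc _ b

/-- `‖τ𝔄‖ < a` for `τ ∈ [0, 1]` from `‖𝔄‖ < a` (the datum of (3.50) at `𝔄₀ = τ𝔄`). [cite: Balaban1987RG1, (3.50) p.279] -/
theorem norm_smul_dat_lt (laws : ChartB12Laws Rz cB χ) {Φ : FieldPair P 0 (MatA N)ˣ (MatA N)} {A : PBond P 0 → MatA N} {τ : ℝ}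
    (hΦ : Φ ∈ space (suModel N) (χ.toResid.frameBox Rz) (χ.toResid.csBox cB) ((1 + 2 * χ.toResid.consts.β) * χ.toResid.consts.α₀)
      ((1 + 2 * χ.toResid.consts.β) * χ.toResid.consts.α₁) χ.toResid.α₀)
    (hA : A ∈ χ.toResid.A331) (hτ0 : 0 ≤ τ) (hτ1 : τ ≤ 1) : ‖(τ : ℂ) • χ.dat Φ A‖ < χ.a := by
  have h := laws.dat_lt Φ A hΦ hA
  have h0 : 0 ≤ ‖χ.dat Φ A‖ := norm_nonneg _
  rw [norm_smul, Complex.norm_real, Real.norm_eq_abs, abs_of_nonneg hτ0]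
  nlinarith

end ChartB12Laws

/-- **The chart laws are jointly satisfiable** (sanity witness at the ZERO scheme `𝒢 = 0, W = 0, T = id, ev = 0, H_{1,j} = 0` with `a = 1`, `Klip = 1`, `B₃ = α₀ = 1`,
`O(1) = L`, at an instance with `j = k = 1`, for `0 < M`): the displayed hypotheses are not contradictory by shape.  Physically vacuous; NOT [15]'s regime at the
record (that is N07 ∕ [15] Props. 6–9). [cite: Balaban1985Variational, Prop. 6 p.295 (bookkeeping)] -/
theorem chartB12Laws_degenerate (Rz : Sect2.Residual P (MatA N)) (cB : ℝ) (hM : 0 < M) :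
    ∃ χ : ChartB12Run P N M 𝒴 𝒵, ChartB12Laws Rz cB χ := by
  have hL : (0 : ℝ) < P.L := by exact_mod_cast lt_trans zero_lt_one P.hL.2
  have hMr : (0 : ℝ) < M := by exact_mod_cast hM
  refine
    ⟨{ idx := { k := 1, j := 1, one_le_j := le_rfl, j_le_k := le_rfl, cube := fun _ => 0, X := Sect2.cubeDom P M 1 fun _ => 0 },
       𝒢 := 0, W := fun _ => 0, T := fun Y => Y, ε₄ := 0, B₀ := 0, θ := 0, C₄ := 0, a₃ := 2, jc := 0, a := 1, Klip := 1, K_D := 0,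
       ev := 0, lin := 0, fldB := fun _ _ _ => 0, A331 := Set.univ,
       B₃ := 1, O₁ := P.L, β₀ := 0, β := 0, α₀ := 1, α₁ := 0, α₂ := 0, α₃ := 0, B₃'' := 0 }, ?_⟩
  have hη : (P.L : ℝ) ^ (1 - 1) * P.eta 1 = (P.L : ℝ)⁻¹ := by simp [Params.eta]
  refine
    { regime :=
        { norm_G := fun f => by simp
          norm_L := fun Y => by simp
          quad := ⟨fun Y _ => by simp, fun _ _ => differentiableOn_const _⟩
          B₀_nonneg := le_rfl
          C₄_nonneg := le_rfl
          θ_nonneg := le_rfl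
          ε₄_nonneg := le_rfl
          dom := by norm_num
          self := by norm_num
          contr := by norm_num }
      jc_nonneg := le_rfl
      T_zero := rfl
      Klip_pos := one_pos
      lip := fun x y _ _ => by simp
      KD_nonneg := le_rfl
      second := fun Y _ => by simp
      ev_le := fun Y b => by simp
      grad_ev_le := fun Y μ ν y => by simp [grad]
      ev_gc := fun Y b => by simp
      dat_lt := fun Φ A _ _ => by simp [ChartB12Run.dat]
      dat_lin_lt := fun Φ A τ B' _ _ _ _ _ => by simp [ChartB12Run.dat]
      h337 := ?_
      h345 := ?_
      h350 := by
        show (1 : ℝ) * ((0 + 4 * 0 * 0 * (0 + 1)) / (1 - (0 + 4 * 0 * 0 * (0 + 1))) + 1) * ‖(0 : (PBond P 0 → MatA N) →L[ℂ] 𝒴)‖ ≤ 1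
        rw [ContinuousLinearMap.opNorm_zero]
        norm_num }
  · show (1 : ℝ) * (0 + 1) ≤ (1 : ℝ) ^ 2 * (P.L : ℝ) * (M : ℝ) * 1 * ((P.L : ℝ) ^ (1 - 1) * P.eta 1)
    rw [hη]
    field_simp
    exact_mod_cast hM
  · show (2 : ℝ) * (0 + 0 * 0) * (0 + 1) ^ 2 < 1 * (1 * (P.L : ℝ) * (M : ℝ) * 1 * ((P.L : ℝ) ^ (1 - 1) * P.eta 1)) ^ 2
    rw [hη]
    have h1 : (1 : ℝ) * (P.L : ℝ) * (M : ℝ) * 1 * (P.L : ℝ)⁻¹ = M := by field_simp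
    rw [h1]
    nlinarith [pow_pos hMr 2]

/-! ## §3. The by-reference residue of p07's `JInputs` once the letters are charted -/

section Ref

variable {i : ℕ} {𝔸 : Type} [NormedRing 𝔸] [NormedAlgebra ℂ 𝔸] [CompleteSpace 𝔸]

/-- **p07's `JInputs` WITH THE [15]-FUNCTION LETTERS AS PARAMETERS AND THE EIGHT SIZES REMOVED** — the by-reference residue for one value `(𝐔, 𝐀, τ, B′)` once
`𝐊, 𝐀₂, 𝐇, H₁` are charted: the upper-space datum `(𝐔⁰, 𝐉⁰)` of (3.40); the gauge transformations `u_j` (3.26), `ū′` (3.37), `v_j`, `v` (3.39)∕(3.41), `ū^{(m)}`,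
`w₁^{(m)}`, centres, with their costs; the identities (3.39)+(3.37), (3.42), (3.38)×2 (and at `U = 1`); the (J2)×2 ∕ (J3) inputs `hS`, `hSτ`, `hA2`.  Field-for-field
p07's `B12Lemma4ConcreteFrame.JInputs` minus `H H₁ ℓ hKgc hAgc hH hHd h45 hK hKd h45τ hA hAd`.
[cite: Balaban1987RG1, (3.26) p.275, (3.37)–(3.42) pp.277–278, (3.40) p.278, Lemma 4 p.280] -/
structure JInputsRef (𝓜 : Model 𝔸) (c : B12Sec2to5.Lemma4Consts) (F F' : Frame P i 𝔸) (cs cs' : StepConsts) (Y : Region P i)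
    (π : 𝔸 →ₗ[ℂ] 𝔸) (η B₃'' γ₀' : ℝ) (j : ℕ) (τ n : ℝ) (K A H H₁ : PBond P i → 𝔸) where
  /-- the upper-space datum (3.40) -/
  Φ₀ : FieldPair P i 𝔸ˣ 𝔸
  hΦ₀ : Satisfies 𝓜 F' cs' ((1 + 2 * c.β) * c.α₀) ((1 + 2 * c.β) * c.α₁) γ₀' Φ₀
  /-- the gauge transformations -/
  uj : Site P i → 𝔸ˣ
  ubar1 : Site P i → 𝔸ˣ
  vj : Site P i → 𝔸ˣ
  v : Site P i → 𝔸ˣ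
  ubar : ℕ → Site P i → 𝔸ˣ
  w₁ : ℕ → Site P i → 𝔸ˣ
  ctr : ℕ → Site P i → Site P i
  /-- costs (3.26)∕(3.37) -/
  huj : ∀ y, ‖(uj y : 𝔸)‖ * ‖(↑(uj y)⁻¹ : 𝔸)‖ ≤ Real.exp (c.B₃ ^ 2 * c.O₁ * c.M * c.α₀)
  hubar1 : ∀ y, ‖(ubar1 y : 𝔸)‖ * ‖(↑(ubar1 y)⁻¹ : 𝔸)‖ ≤ Real.exp (c.B₃ * c.O₁ * c.M * c.α₀)
  hvj : ∀ y, ‖(vj y : 𝔸)‖ * ‖(↑(vj y)⁻¹ : 𝔸)‖ ≤ Real.exp (c.B₃ * c.O₁ * c.M * c.α₀)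
  hv : ∀ y, ‖(v y : 𝔸)‖ * ‖(↑(v y)⁻¹ : 𝔸)‖ ≤ Real.exp (c.O₁ * c.M * c.α₁)
  hubar : ∀ n x, ubar n x = uj (ctr n x)
  /-- the identities (3.39)+(3.37), (3.42), (3.38)×2 -/
  h339 : ∀ p ∈ F.X.plaqs,
    plaq (fun b => expI cs.ξ (H b)) p = plaq (gaugeU (v * ubar1 * vj * uj)⁻¹ (F'.bg.Un cs'.j Φ₀.U)) p
  h342 : ∀ b ∈ Y.bonds, current π cs.ξ (fun b => expI cs.ξ (H b)) b =
    ((((v * ubar1 * vj * uj)⁻¹ : Site P i → 𝔸ˣ) b.src : 𝔸ˣ) : 𝔸) *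
      ((((c.L ^ (j - 1) * η : ℝ) : ℂ) ^ 3) • F'.bg.Jn cs'.j Φ₀.U b) * ↑((((v * ubar1 * vj * uj)⁻¹ : Site P i → 𝔸ˣ) b.src)⁻¹ : 𝔸ˣ)
  h338 : ∀ m, 1 ≤ m → m ≤ cs.j → ∀ p ∈ F.X₂.plaqs, plaq (F.bg.Un m (fun b => expI cs.ξ (K b + A b))) p =
    plaq (gaugeU (uj * (ubar m)⁻¹) (fun b => expI cs.ξ (K b + A b))) p
  hJn : ∀ m, 1 ≤ m → m ≤ cs.j → ∀ b ∈ F.X₂.bonds, F.bg.Jn m (fun b => expI cs.ξ (K b + A b)) b =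
    current π (cs.L ^ m)⁻¹ (gaugeU (uj * (ubar m)⁻¹) (fun b => expI cs.ξ (K b + A b))) b
  h338₁ : ∀ m, 1 ≤ m → m ≤ cs.j → ∀ p ∈ F.X₂.plaqs,
    plaq (F.bg.Un m (1 : PBond P i → 𝔸ˣ)) p = plaq (gaugeU (w₁ m) (1 : PBond P i → 𝔸ˣ)) p
  hJn₁ : ∀ m, 1 ≤ m → m ≤ cs.j → ∀ b ∈ F.X₂.bonds,
    F.bg.Jn m (1 : PBond P i → 𝔸ˣ) b = current π (cs.L ^ m)⁻¹ (gaugeU (w₁ m) (1 : PBond P i → 𝔸ˣ)) b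
  /-- the (J2)×2, (J3) inputs -/
  hS : ∀ b ∈ Y.bonds, ‖lapCur π cs.ξ (1 : PBond P i → 𝔸ˣ) (H - H₁) b‖ < c.β * c.α₀ * (c.L ^ (j - 1) * η) ^ 2
  hSτ : ∀ b ∈ Y.bonds, ‖lapCur π cs.ξ (1 : PBond P i → 𝔸ˣ) (K - (τ : ℂ) • H₁) b‖ < c.β * c.α₀ * (c.L ^ (j - 1) * η) ^ 2
  hA2 : ∀ b ∈ Y.bonds, ‖lapCur π cs.ξ (1 : PBond P i → 𝔸ˣ) A b‖ ≤ B₃'' * n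

namespace JInputsRef

variable {𝓜 : Model 𝔸} {c : B12Sec2to5.Lemma4Consts} {F F' : Frame P i 𝔸} {cs cs' : StepConsts} {Y : Region P i}
  {π : 𝔸 →ₗ[ℂ] 𝔸} {η B₃'' γ₀' : ℝ} {j : ℕ} {τ n : ℝ} {K A H H₁ : PBond P i → 𝔸}

/-- **PUT THE SIZES BACK**: p07's `JInputs` from the residue, the linear term `ℓ`, `𝔤ᶜ`-valuedness and the eight sizes (3.37)×4, (3.45)×2, (3.50)×2 as hypotheses
(a field shuffle; no mathematics). [cite: Balaban1987RG1, (3.37) p.277, (3.45) p.279, (3.50) p.280, Lemma 4 p.280] -/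
def toJInputs (R : JInputsRef 𝓜 c F F' cs cs' Y π η B₃'' γ₀' j τ n K A H H₁) (ℓ : Plaq P i → 𝔸)
    (hKgc : ∀ b, K b ∈ 𝓜.gc) (hAgc : ∀ b, A b ∈ 𝓜.gc)
    (hH : ∀ b, ‖H b‖ < c.B₃ ^ 2 * c.O₁ * c.M * c.α₀ * (c.L ^ (j - 1) * η))
    (hHd : ∀ μ ν y, ‖grad cs.ξ μ (fun z => H ⟨z, ν⟩) y‖ < c.B₃ ^ 2 * c.O₁ * c.M * c.α₀ * (c.L ^ (j - 1) * η))
    (h45 : ∀ p ∈ F.X.plaqs, ‖(cs.ξ : ℂ)⁻¹ • (H ⟨p.src, p.μ⟩ + H ⟨p.src.shift p.μ, p.ν⟩ - H ⟨p.src.shift p.ν, p.μ⟩ -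
      H ⟨p.src, p.ν⟩) - ℓ p‖ < c.B₃ * (c.B₃ * c.O₁ * c.M * c.α₀ * (c.L ^ (j - 1) * η)) ^ 2)
    (hK : ∀ b, ‖K b‖ < c.B₃ ^ 2 * c.O₁ * c.M * c.α₀ * (c.L ^ (j - 1) * η))
    (hKd : ∀ μ ν y, ‖grad cs.ξ μ (fun z => K ⟨z, ν⟩) y‖ < c.B₃ ^ 2 * c.O₁ * c.M * c.α₀ * (c.L ^ (j - 1) * η))
    (h45τ : ∀ p ∈ F.X.plaqs, ‖(cs.ξ : ℂ)⁻¹ • (K ⟨p.src, p.μ⟩ + K ⟨p.src.shift p.μ, p.ν⟩ - K ⟨p.src.shift p.ν, p.μ⟩ -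
      K ⟨p.src, p.ν⟩) - (τ : ℂ) • ℓ p‖ < c.B₃ * (c.B₃ * c.O₁ * c.M * c.α₀ * (c.L ^ (j - 1) * η)) ^ 2)
    (hA : ∀ b, ‖A b‖ ≤ c.B₃ * n) (hAd : ∀ μ ν y, ‖grad cs.ξ μ (fun z => A ⟨z, ν⟩) y‖ ≤ c.B₃ * n) :
    JInputs 𝓜 c F F' cs cs' Y π η B₃'' γ₀' j τ n K A where
  Φ₀ := R.Φ₀
  hΦ₀ := R.hΦ₀
  H := H
  H₁ := H₁
  ℓ := ℓ
  uj := R.uj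
  ubar1 := R.ubar1
  vj := R.vj
  v := R.v
  ubar := R.ubar
  w₁ := R.w₁
  ctr := R.ctr
  hKgc := hKgc
  hAgc := hAgc
  huj := R.huj
  hubar1 := R.hubar1
  hvj := R.hvj
  hv := R.hv
  hubar := R.hubar
  h339 := R.h339
  h342 := R.h342
  h338 := R.h338
  hJn := R.hJn
  h338₁ := R.h338₁
  hJn₁ := R.hJn₁
  hH := hH
  hHd := hHd
  h45 := h45
  hK := hK
  hKd := hKd
  h45τ := h45τ
  hA := hA
  hAd := hAd
  hS := R.hS
  hSτ := R.hSτ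
  hA2 := R.hA2

/-- **FORGET THE SIZES**: the residue of a full package (its letters `𝐇`, `H₁` become the parameters). [cite: Balaban1987RG1, Lemma 4 p.280] -/
def ofJInputs (J : JInputs 𝓜 c F F' cs cs' Y π η B₃'' γ₀' j τ n K A) : JInputsRef 𝓜 c F F' cs cs' Y π η B₃'' γ₀' j τ n K A J.H J.H₁ where
  Φ₀ := J.Φ₀
  hΦ₀ := J.hΦ₀
  uj := J.uj
  ubar1 := J.ubar1
  vj := J.vj
  v := J.v
  ubar := J.ubar
  w₁ := J.w₁
  ctr := J.ctr
  huj := J.huj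
  hubar1 := J.hubar1
  hvj := J.hvj
  hv := J.hv
  hubar := J.hubar
  h339 := J.h339
  h342 := J.h342
  h338 := J.h338
  hJn := J.hJn
  h338₁ := J.h338₁
  hJn₁ := J.hJn₁
  hS := J.hS
  hSτ := J.hSτ
  hA2 := J.hA2

/-- Residue + the removed fields = the package (the residue IS `JInputs` minus those fields). [cite: Balaban1987RG1, Lemma 4 p.280] -/
theorem toJInputs_ofJInputs (J : JInputs 𝓜 c F F' cs cs' Y π η B₃'' γ₀' j τ n K A) :
    (ofJInputs J).toJInputs J.ℓ J.hKgc J.hAgc J.hH J.hHd J.h45 J.hK J.hKd J.h45τ J.hA J.hAd = J := rfl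

end JInputsRef

end Ref

/-! ## §4. The charted fundamental-case record and the knit to module C's `B12FundamentalInputs` -/

section Inputs

variable {Rz : Sect2.Residual P (MatA N)} {cB : ℝ}

/-- **THE FUNDAMENTAL-CASE INPUTS OF A CHARTED RUN** — module C's `B12FundamentalInputs Rz cB χ.toResid` with the package field `inputs : … → JInputs …` REPLACED by
the residue `inputsRef : … → JInputsRef …` AT THE CHARTED LETTERS `χ.K`, `χ.A₂`, `χ.H`, `χ.H₁` (the eight sizes and `𝔤ᶜ`-valuedness are no longer inputs: they follow
from the chart laws, `toFundamental`).  Kept verbatim: «X ⊂ □̃²» (`hX`, print p. 273 with «□₀ = □̃⁵»), the seven restrictions of p07's `Lemma4Data`, and the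
analyticity of the letters along analytic families (`hKan`, `hA2an` — at the pin a consequence of [15] Prop. 7 and of the datum's analyticity, p. 276 «explicitly
given analytic functions of 𝐔»; successor work).  STATUS: a Type of inputs; NOT inhabited here; N09 is NOT discharged.
[cite: Balaban1987RG1, Lemma 4 (3.53) p.280 with (3.26)–(3.52) pp.275–280; p.273 («X ⊂ □̃²», «□₀ = □̃⁵»)] [cite: Balaban1985Variational, (174)–(177) pp.305–306] -/
structure ChartB12Inputs (Rz : Sect2.Residual P (MatA N)) (cB : ℝ) (χ : ChartB12Run P N M 𝒴 𝒵) where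
  /-- the fundamental case «X ⊂ □̃²» -/
  hX : χ.idx.XSites ⊆ χ.idx.boxT 2
  /-- the restrictions of p07's `Lemma4Data` at the layer's constants -/
  hB : 1 ≤ χ.toResid.consts.B₃
  hY : 1 ≤ χ.toResid.consts.B₃ ^ 2 * χ.toResid.consts.O₁ * χ.toResid.consts.M
  hα₁ : 16 * (χ.toResid.consts.O₁ * χ.toResid.consts.M * χ.toResid.consts.α₁) ≤ χ.toResid.consts.β
  hL10 : 1 + 10 * χ.toResid.consts.β ≤ χ.toResid.consts.L ^ 2
  hB'' : 0 ≤ χ.toResid.B₃''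
  hres'' : χ.toResid.B₃'' * χ.toResid.consts.α₃ ≤ χ.toResid.consts.β * χ.toResid.consts.L⁻¹ ^ 2 * χ.toResid.consts.α₀
  hresJ : 4 * ((P.d - 1) * ((2 : ℝ) * C311 1)) * (χ.toResid.consts.B₃ ^ 2 * χ.toResid.consts.O₁ * χ.toResid.consts.M) ^ 2 * χ.toResid.consts.α₀ ≤
    χ.toResid.consts.β
  /-- the by-reference residue of p07's package at every value of the variables in the printed domain, AT THE CHARTED LETTERS -/
  inputsRef : ∀ (Φ : FieldPair P 0 (MatA N)ˣ (MatA N)) (A : PBond P 0 → MatA N) (τ : ℝ) (B' : PBond P 0 → MatA N),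
    Φ ∈ space (suModel N) (χ.toResid.frameBox Rz) (χ.toResid.csBox cB) ((1 + 2 * χ.toResid.consts.β) * χ.toResid.consts.α₀)
        ((1 + 2 * χ.toResid.consts.β) * χ.toResid.consts.α₁) χ.toResid.α₀ →
      A ∈ χ.toResid.A331 → 0 ≤ τ → τ ≤ 1 → ‖B'‖ < χ.toResid.consts.α₃ →
        JInputsRef (suModel N) χ.toResid.consts (χ.toResid.frameX Rz) (χ.toResid.frameBox Rz) (χ.toResid.csX cB) (χ.toResid.csBox cB)
          χ.toResid.regionY (slProj N) χ.toResid.idx.η χ.toResid.B₃'' χ.toResid.α₀ χ.toResid.idx.j τ ‖B'‖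
          (χ.K Φ A τ) (χ.A₂ Φ A τ B') (χ.H Φ A) (χ.H₁ Φ A)
  /-- analyticity of the letters of the pinned `𝐊` along analytic families with values in the domain -/
  hKan : ∀ {E : Type} [NormedAddCommGroup E] [NormedSpace ℂ E] {Φf : E → FieldPair P 0 (MatA N)ˣ (MatA N)}
    {Af Bf : E → PBond P 0 → MatA N} {e₀ : E} (τ : ℝ), LettersAnalyticAt Φf Af Bf e₀ →
      Φf e₀ ∈ space (suModel N) (χ.toResid.frameBox Rz) (χ.toResid.csBox cB) ((1 + 2 * χ.toResid.consts.β) * χ.toResid.consts.α₀)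
          ((1 + 2 * χ.toResid.consts.β) * χ.toResid.consts.α₁) χ.toResid.α₀ →
        Af e₀ ∈ χ.toResid.A331 → 0 ≤ τ → τ ≤ 1 → ‖Bf e₀‖ < χ.toResid.consts.α₃ → ∀ b, AnalyticAt ℂ (fun e => χ.K (Φf e) (Af e) τ b) e₀
  /-- analyticity of the letters of the pinned `𝐀₂` along analytic families with values in the domain -/
  hA2an : ∀ {E : Type} [NormedAddCommGroup E] [NormedSpace ℂ E] {Φf : E → FieldPair P 0 (MatA N)ˣ (MatA N)}
    {Af Bf : E → PBond P 0 → MatA N} {e₀ : E} (τ : ℝ), LettersAnalyticAt Φf Af Bf e₀ →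
      Φf e₀ ∈ space (suModel N) (χ.toResid.frameBox Rz) (χ.toResid.csBox cB) ((1 + 2 * χ.toResid.consts.β) * χ.toResid.consts.α₀)
          ((1 + 2 * χ.toResid.consts.β) * χ.toResid.consts.α₁) χ.toResid.α₀ →
        Af e₀ ∈ χ.toResid.A331 → 0 ≤ τ → τ ≤ 1 → ‖Bf e₀‖ < χ.toResid.consts.α₃ → ∀ b, AnalyticAt ℂ (fun e => χ.A₂ (Φf e) (Af e) τ (Bf e) b) e₀

namespace ChartB12Inputs

variable {χ : ChartB12Run P N M 𝒴 𝒵}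

/-- **THE KNIT: a charted run's fundamental-case inputs + the chart laws ⇒ module C's `B12FundamentalInputs` at the presented residual layer** — the package
`JInputs` at every value of the variables is the residue with `ℓ := χ.ℓ`, `hKgc ∕ hAgc := laws.ev_gc`, and THE EIGHT SIZES := dag-n09-b's theorems BY NAME:
`hH ∕ hHd := ineq337_letter_one ∕ ineq337_grad_one` ((3.37) at `τ = 1`), `h45 := ineq345_one` ((3.45)), `hK ∕ hKd := ineq337_letter ∕ ineq337_grad` ((3.37) for
`τQ(…)`), `h45τ := ineq345_tau`, `hA ∕ hAd := ineq350_letter ∕ ineq350_grad` ((3.50), `n = ‖B′‖`).  The elaboration of this definition CERTIFIES that the pinned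
letters have exactly the shapes dag-n09-b's theorems conclude and p07's `JInputs` expects.  No estimate is proved here.
[cite: Balaban1987RG1, (3.37) p.277, (3.45) p.279, (3.50) pp.279–280, Lemma 4 (3.53) p.280] [cite: Balaban1985Variational, (176)–(177) p.306, Prop. 9 p.309] -/
def toFundamental [CompleteSpace 𝒴] (h : ChartB12Inputs Rz cB χ) (laws : ChartB12Laws Rz cB χ) : B12FundamentalInputs Rz cB χ.toResid where
  hX := h.hX
  hB := h.hB
  hY := h.hY
  hα₁ := h.hα₁
  hL10 := h.hL10
  hB'' := h.hB''
  hres'' := h.hres''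
  hresJ := h.hresJ
  inputs Φ A τ B' hΦ hA hτ0 hτ1 hB' :=
    (h.inputsRef Φ A τ B' hΦ hA hτ0 hτ1 hB').toJInputs (χ.ℓ cB Φ A) (laws.K_mem_gc Φ A τ) (laws.A₂_mem_gc Φ A τ B')
      (ineq337_letter_one χ.ev laws.ev_le laws.regime laws.jc_nonneg (laws.dat_lt Φ A hΦ hA) laws.Klip_pos laws.T_zero laws.lip laws.h337)
      (ineq337_grad_one χ.ev laws.grad_ev_le laws.regime laws.jc_nonneg (laws.dat_lt Φ A hΦ hA) laws.Klip_pos laws.T_zero laws.lip laws.h337)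
      (fun p _ => ineq345_one χ.ev laws.grad_ev_le laws.regime laws.jc_nonneg (laws.dat_lt Φ A hΦ hA) laws.KD_nonneg laws.second laws.h345 p)
      (ineq337_letter χ.ev laws.ev_le laws.regime laws.jc_nonneg (laws.dat_lt Φ A hΦ hA) hτ0 hτ1 laws.Klip_pos laws.T_zero laws.lip laws.h337)
      (ineq337_grad χ.ev laws.grad_ev_le laws.regime laws.jc_nonneg (laws.dat_lt Φ A hΦ hA) hτ0 hτ1 laws.Klip_pos laws.T_zero laws.lip laws.h337)
      (fun p _ => ineq345_tau χ.ev laws.grad_ev_le laws.regime laws.jc_nonneg (laws.dat_lt Φ A hΦ hA) hτ0 hτ1 laws.KD_nonneg laws.second laws.h345 p)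
      (ineq350_letter χ.ev laws.ev_le laws.regime laws.jc_nonneg χ.lin (laws.norm_smul_dat_lt hΦ hA hτ0 hτ1)
        (laws.dat_lin_lt Φ A τ B' hΦ hA hτ0 hτ1 hB') laws.Klip_pos.le laws.lip le_rfl laws.h350)
      (ineq350_grad χ.ev laws.grad_ev_le laws.regime laws.jc_nonneg χ.lin (laws.norm_smul_dat_lt hΦ hA hτ0 hτ1)
        (laws.dat_lin_lt Φ A τ B' hΦ hA hτ0 hτ1 hB') laws.Klip_pos.le laws.lip le_rfl laws.h350)
  hKan τ hLe hΦ hA hτ0 hτ1 hB' := h.hKan τ hLe hΦ hA hτ0 hτ1 hB'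
  hA2an τ hLe hΦ hA hτ0 hτ1 hB' := h.hA2an τ hLe hΦ hA hτ0 hτ1 hB'

/-- The package's `𝐇` IS the pinned `𝐇 = ev 𝓗(𝔄)`. [cite: Balaban1987RG1, (3.39) p.277] -/
theorem toFundamental_inputs_H [CompleteSpace 𝒴] (h : ChartB12Inputs Rz cB χ) (laws : ChartB12Laws Rz cB χ)
    (Φ : FieldPair P 0 (MatA N)ˣ (MatA N)) (A : PBond P 0 → MatA N) (τ : ℝ) (B' : PBond P 0 → MatA N)
    (hΦ : Φ ∈ space (suModel N) (χ.toResid.frameBox Rz) (χ.toResid.csBox cB) ((1 + 2 * χ.toResid.consts.β) * χ.toResid.consts.α₀)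
      ((1 + 2 * χ.toResid.consts.β) * χ.toResid.consts.α₁) χ.toResid.α₀)
    (hA : A ∈ χ.toResid.A331) (hτ0 : 0 ≤ τ) (hτ1 : τ ≤ 1) (hB' : ‖B'‖ < χ.toResid.consts.α₃) :
    ((h.toFundamental laws).inputs Φ A τ B' hΦ hA hτ0 hτ1 hB').H = χ.H Φ A := rfl

/-- The package's `H₁` IS the pinned `H₁ = ev 𝔄`. [cite: Balaban1987RG1, p.279] -/
theorem toFundamental_inputs_H₁ [CompleteSpace 𝒴] (h : ChartB12Inputs Rz cB χ) (laws : ChartB12Laws Rz cB χ)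
    (Φ : FieldPair P 0 (MatA N)ˣ (MatA N)) (A : PBond P 0 → MatA N) (τ : ℝ) (B' : PBond P 0 → MatA N)
    (hΦ : Φ ∈ space (suModel N) (χ.toResid.frameBox Rz) (χ.toResid.csBox cB) ((1 + 2 * χ.toResid.consts.β) * χ.toResid.consts.α₀)
      ((1 + 2 * χ.toResid.consts.β) * χ.toResid.consts.α₁) χ.toResid.α₀)
    (hA : A ∈ χ.toResid.A331) (hτ0 : 0 ≤ τ) (hτ1 : τ ≤ 1) (hB' : ‖B'‖ < χ.toResid.consts.α₃) :
    ((h.toFundamental laws).inputs Φ A τ B' hΦ hA hτ0 hτ1 hB').H₁ = χ.H₁ Φ A := rfl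

/-- The package's `ℓ` IS the pinned `ℓ = ∂^ξ H₁`. [cite: Balaban1987RG1, (3.45) p.279] -/
theorem toFundamental_inputs_ℓ [CompleteSpace 𝒴] (h : ChartB12Inputs Rz cB χ) (laws : ChartB12Laws Rz cB χ)
    (Φ : FieldPair P 0 (MatA N)ˣ (MatA N)) (A : PBond P 0 → MatA N) (τ : ℝ) (B' : PBond P 0 → MatA N)
    (hΦ : Φ ∈ space (suModel N) (χ.toResid.frameBox Rz) (χ.toResid.csBox cB) ((1 + 2 * χ.toResid.consts.β) * χ.toResid.consts.α₀)
      ((1 + 2 * χ.toResid.consts.β) * χ.toResid.consts.α₁) χ.toResid.α₀)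
    (hA : A ∈ χ.toResid.A331) (hτ0 : 0 ≤ τ) (hτ1 : τ ≤ 1) (hB' : ‖B'‖ < χ.toResid.consts.α₃) :
    ((h.toFundamental laws).inputs Φ A τ B' hΦ hA hτ0 hτ1 hB').ℓ = χ.ℓ cB Φ A := rfl

/-- **Module A's package at the presented residual layer from a charted run** (module C's `toPackage` on the knit).  NOT a discharge of N09.
[cite: Balaban1987RG1, Lemma 4 (3.53) p.280 with (3.26)–(3.52) pp.275–280] -/
def package_of_chart [CompleteSpace 𝒴] (h : ChartB12Inputs Rz cB χ) (laws : ChartB12Laws Rz cB χ) : B12Package Rz cB χ.toResid :=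
  (h.toFundamental laws).toPackage

/-- **LEMMA 4 (3.53) AT THE GROUP OF RECORD FROM A CHARTED RUN'S INPUTS AND ITS CHART LAWS** (module C's `leaf` on the knit; = dag-n09-c's closer; = p07's
`lemma4Printed_frameOf`).  NOT a discharge of N09: the residue, the analyticity and the laws are hypotheses.
[cite: Balaban1987RG1, Lemma 4 (3.53) p.280, p.273 («the fundamental case X ⊂ □̃²»)] [cite: Balaban1985Variational, Prop. 9 p.309] -/
theorem leaf_of_chart [NeZero N] [CompleteSpace 𝒴] (h : ChartB12Inputs Rz cB χ) (laws : ChartB12Laws Rz cB χ) (hcB : 0 < cB) :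
    B12LeafOfRecord Rz cB χ.toResid :=
  (h.toFundamental laws).leaf hcB

/-- … and the layer's provisos (module A's `B12Provisos`) given «all the restrictions» and `0 ∈ (3.31)`. [cite: Balaban1987RG1, Lemma 4 (3.53) p.280; (3.31) p.276] -/
theorem provisos_of_chart [CompleteSpace 𝒴] (h : ChartB12Inputs Rz cB χ) (laws : ChartB12Laws Rz cB χ)
    (hr : B12Sec2to5.Lemma4Restrictions χ.toResid.consts) (h0 : (0 : PBond P 0 → MatA N) ∈ χ.toResid.A331) : B12Provisos Rz cB χ.toResid :=
  (h.toFundamental laws).provisos hr h0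

end ChartB12Inputs

end Inputs

end Chart

/-! ## §5. At def-T's STAGE 12: the leaf of THE NAMED charted layer; a proviso-record world for a charted family -/

section Stage12

variable (F : T4Family) (N : ℕ) [NeZero N]

/-- **THE STAGE-12 LEAF OF A NAMED CHARTED LAYER** — `B12LeafOfRecord₁₂ F N θ (fun q => (χ q).toResid) p` from the charted run's fundamental-case inputs and chart
laws at run `p` and Stage-12 admissibility (module C's `b12LeafOfRecord₁₂_of_fundamentalInputs` on the knit).  ONE named layer, no record predicate, no
∀-over-presenting-layers binder (modules A ∕ C §4).  NOT a discharge of N09.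
[cite: Balaban1987RG1, Lemma 4 (3.53) p.280, p.273 («the fundamental case X ⊂ □̃²»)] [cite: Balaban1985Variational, Prop. 9 p.309] -/
theorem b12LeafOfRecord₁₂_of_chart (θ : Stage12Params F N) (hθ : θ.Admissible F N)
    {𝒴 𝒵 : B12.RunParams → Type} [∀ p, NormedAddCommGroup (𝒴 p)] [∀ p, NormedSpace ℂ (𝒴 p)] [∀ p, CompleteSpace (𝒴 p)]
    [∀ p, NormedAddCommGroup (𝒵 p)] [∀ p, NormedSpace ℂ (𝒵 p)]
    (χ : ∀ p : B12.RunParams, ChartB12Run (F.P p.K) N θ.τ9.M (𝒴 p) (𝒵 p)) (p : B12.RunParams)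
    (h : ChartB12Inputs (θ.Rz p.K) θ.s2.cB (χ p)) (laws : ChartB12Laws (θ.Rz p.K) θ.s2.cB (χ p)) :
    B12LeafOfRecord₁₂ F N θ (fun q => (χ q).toResid) p :=
  b12LeafOfRecord₁₂_of_fundamentalInputs F N θ hθ (fun q => (χ q).toResid) p (h.toFundamental laws)

/-- **A PROVISO-CARRYING RECORD WORLD FOR A CHARTED FAMILY, WITH N09's CONJUNCT 1 AT EVERY RUN** (module C's `exists_world_b12_of_fundamental` on the knit at every
run).  STATUS: a PROVISO-CARRYING SUCCESSOR record, NOT the world of record; GAP-STATED(residue, analyticity, chart laws); count-neutral; NOT a discharge of N09.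
[cite: Balaban1989LargeFieldII, Thm 1 + (0.1) pp.355–356 (bookkeeping); Balaban1987RG1, Lemma 4 (3.53) p.280, p.273 («the fundamental case X ⊂ □̃²»)] -/
theorem exists_world_b12_of_chart (θ : Stage12Params F N) (hP : θ.Provisos₁₂ F N) (hθ : θ.Admissible F N)
    {𝒴 𝒵 : B12.RunParams → Type} [∀ p, NormedAddCommGroup (𝒴 p)] [∀ p, NormedSpace ℂ (𝒴 p)] [∀ p, CompleteSpace (𝒴 p)]
    [∀ p, NormedAddCommGroup (𝒵 p)] [∀ p, NormedSpace ℂ (𝒵 p)]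
    (χ : ∀ p : B12.RunParams, ChartB12Run (F.P p.K) N θ.τ9.M (𝒴 p) (𝒵 p))
    (lam : ResidB8 θ.toStage3Params) (Mstar : ℕ) (ops : OpsY N θ.toStage3Params Mstar) (ζ : ResidZ F N) (lamW : ResidW F N)
    (h : ∀ p : B12.RunParams, ChartB12Inputs (θ.Rz p.K) θ.s2.cB (χ p)) (laws : ∀ p : B12.RunParams, ChartB12Laws (θ.Rz p.K) θ.s2.cB (χ p))
    (hr : ∀ p : B12.RunParams, B12Sec2to5.Lemma4Restrictions (χ p).toResid.consts)
    (h0 : ∀ p : B12.RunParams, (0 : PBond (F.P p.K) 0 → MatA N) ∈ (χ p).toResid.A331) {γw : ℝ} (hγw : 0 < γw ∧ γw ≤ θ.γ) :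
    ∃ w : WorldP, IsRecordOfRecord₁₂CB10YZWB8B12Prov F N (datumOfRecord₁₂ F N θ hP) w ∧ w.γ = γw ∧ ∀ p : B12.RunParams, (leavesP w p).b12 :=
  exists_world_b12_of_fundamental F N θ hP hθ (fun q => (χ q).toResid) lam Mstar ops ζ lamW (fun p => (h p).toFundamental (laws p)) hr h0 hγw

end Stage12

end Literature.MathematicalPhysics.QuantumFieldTheory.Balaban1983to89.Node00

end
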